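import Mathlib
import HarnessLib
import Literature.Probability.MarkovChains.TotalVariation

/-!
# The bottleneck ratio and the lower bound `t_mix ≥ 1/(4Φ⋆)` (Levin–Peres–Wilmer, Theorem 7.4)

HONEST FRAMING: exact (Metropolis-corrected) sampling algorithms for lattice gauge theory; figures
of merit are autocorrelation/cost numbers at stated couplings and volumes; no continuum-physics claim.

Finite state space `X`, ROW kernel `P : X → X → ℝ` (`P x y` = probability of the move `x → y`),
laws as vectors `X → ℝ`, `lawAt P μ t = μPᵗ`, `tvDist` = total variation in half-`ℓ¹` form — the
conventions of `MetropolisHastings.lean` / `TotalVariation.lean`.  Everything below is PROVED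
(finite sums; 0 named facts).  Source: D. A. Levin, Y. Peres (with E. L. Wilmer), *Markov Chains
and Mixing Times*, 2nd ed., AMS 2017 [LevinPeres2017], §4.4–4.5 and §7.2.

* `worstTvDist P π t = max_x ‖Pᵗ(x,·) − π‖_TV` — the book's `d(t)` [cite: LevinPeres2017, §4.4
  eq. (4.22)] (written as `⨆ x`, which is the `max` on a finite nonempty `X` and `0` on an empty
  one); `tvDist_lawAt_le_worstTvDist` — `‖μPᵗ − π‖_TV ≤ d(t)` for every probability vector `μ`
  (the direction `sup_μ ‖μPᵗ − π‖_TV ≤ d(t)` of [cite: LevinPeres2017, §4.5 Exercise 4.1]);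
  `worstTvDist_antitone` — `d` is non-increasing [cite: LevinPeres2017, §4.5 (Exercise 4.2)].
* `mixingTime P π ε = min {t : d(t) ≤ ε}` [cite: LevinPeres2017, §4.5 eq. (4.30)], and
  `t_mix = mixingTime P π (1/4)` [eq. (4.31)]; junk value `0` when no `t` qualifies (documented;
  the theorems below that mention `mixingTime` assume some `t` qualifies, which holds for every
  irreducible aperiodic chain by the convergence theorem, not formalised here).  The fixed-start
  quantity `mixingTimeFrom` of `TotalVariation.lean` is bounded by it (`mixingTimeFrom_le_mixingTime`).
* `edgeMeasure π P A B = Q(A,B) = Σ_{x∈A, y∈B} π(x) P(x,y)` [cite: LevinPeres2017, §7.2 eq. (7.5)];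
  `bottleneckRatio π P S = Φ(S) = Q(S,Sᶜ)/π(S)` [eq. (7.6)]; `bottleneckRatioStar π P = Φ⋆ =
  min {Φ(S) : π(S) ≤ 1/2}` [eq. (7.7)] — the minimum is taken over the sets with `0 < π(S) ≤ 1/2`
  (for `π(S) = 0` the printed quotient is undefined; for an irreducible chain `π > 0` and this is
  "`S ≠ ∅`"), and it is ATTAINED (`exists_bottleneckRatioStar_eq`).
* `condLaw π S` — `π` conditioned on `S`, the law of `X₀` given `X₀ ∈ S` under `P_π`;
  `sum_compl_lawAt_condLaw_le` — **eq. (7.10)**: `P_π{X_t ∈ Sᶜ | X₀ ∈ S} ≤ t·Φ(S)`;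
  `exists_mem_sum_compl_lawAt_single_le` — "so there exists `x` with `Pᵗ(x,S) ≥ 1 − tΦ(S)`";
  `one_sub_sub_le_worstTvDist` — "therefore `d(t) ≥ 1 − tΦ(S) − π(S)`" [cite: LevinPeres2017,
  §7.2, proof of Thm 7.4].
* **THEOREM 7.4** [cite: LevinPeres2017, §7.2 Thm 7.4 eq. (7.9)]: `t_mix = t_mix(1/4) ≥ 1/(4Φ⋆)`.
  Typed in three forms: `LevinPeres2017_thm_7_4_set` (for every `S` with `0 < π(S) ≤ 1/2` and
  every `t` with `d(t) ≤ 1/4`: `1 ≤ 4·t·Φ(S)` — the proof's "t_mix ≥ 1/[4Φ(A)]", division-free);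
  `LevinPeres2017_thm_7_4` (`1 ≤ 4·t·Φ⋆` whenever `d(t) ≤ 1/4` and some `S` has
  `0 < π(S) ≤ 1/2`); `LevinPeres2017_thm_7_4_tmix` (as printed: `1/(4Φ⋆) ≤ t_mix`, for a chain
  that is `1/4`-close at some time).  Also the general-`ε` form `one_sub_sub_le_mul_bottleneckRatio`
  (`d(t) ≤ ε ⇒ 1 − π(S) − ε ≤ t·Φ(S)`).

Proof = the printed one (2nd edition): for the stationary chain,
`P_π{X₀ ∈ A, X_t ∈ Aᶜ} ≤ Σ_{r=1}^{t} P_π{X_{r−1} ∈ A, X_r ∈ Aᶜ} = t·Q(A,Aᶜ)`; in vector form this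
is the induction `ν_{t+1}(Aᶜ) ≤ ν_t(Aᶜ) + Φ(A)` for `ν_t = condLaw π A · Pᵗ`, using
`ν_t ≤ π/π(A)` pointwise (stationarity); the passage from the conditional law to one starting
STATE is linearity `μPᵗ = Σ_x μ(x) δ_x Pᵗ` plus a weighted-average witness; then the event form
of total variation (`TotalVariation.sub_sum_le_tvDist`).  Hypotheses throughout: `P`
row-stochastic, `πP = π`, `π ≥ 0`, `Σ π = 1` — irreducibility / aperiodicity are not needed for
the inequality itself.

Context (cell pub-lqcd, venture LatticeQCDFlow): the bottleneck / conductance inequality is the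
NEAREST PRIOR ART named by `Summits/Ventures/LatticeQCDFlow/Scaling/BarriersTunnelling.lean`
(`LocalMoveTunnellingLaw`, "[cite: LevinPeres2017, Thm 7.4 (bottleneck ratio)]") and the
mechanism behind the IMH sector floors of `Exactness/FlowMCMC.lean`; before this file the tree had
no typed `d(t)`, `t_mix`, `Φ(S)`, `Φ⋆` or Theorem 7.4.  Not here: the upper bound / Cheeger
inequality for the spectral gap (Thm 13.10, Jerrum–Sinclair), the convergence theorem, `d̄(t)`.
-/

namespace Literature.Probability.MarkovChains

open Finset

variable {X : Type*} [Fintype X] [DecidableEq X]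

/-! ## `d(t)` and `t_mix(ε)` -/

/-- `d(t) = max_{x ∈ X} ‖Pᵗ(x,·) − π‖_TV`, the worst-case (over starting states) total variation
distance to `π` at time `t`; `Pᵗ(x,·) = lawAt P (Pi.single x 1) t`.  Written as `⨆ x`, i.e. the
maximum over the finite `X` (and `0` if `X` is empty).
[cite: LevinPeres2017, §4.4 eq. (4.22)] -/
noncomputable def worstTvDist (P : X → X → ℝ) (π : X → ℝ) (t : ℕ) : ℝ :=
  ⨆ x : X, tvDist (lawAt P (Pi.single x 1) t) π

/-- `t_mix(ε) = min {t : d(t) ≤ ε}` (junk value `0` when no such `t` exists, by `Nat.sInf_empty`);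
`t_mix := t_mix(1/4)` is `mixingTime P π (1/4)`.
[cite: LevinPeres2017, §4.5 eqs. (4.30)–(4.31)] -/
noncomputable def mixingTime (P : X → X → ℝ) (π : X → ℝ) (ε : ℝ) : ℕ :=
  sInf {t | worstTvDist P π t ≤ ε}

/-- `d(t) ≥ 0`. [cite: LevinPeres2017, §4.4 eq. (4.22)] -/
theorem worstTvDist_nonneg (P : X → X → ℝ) (π : X → ℝ) (t : ℕ) : 0 ≤ worstTvDist P π t :=
  Real.iSup_nonneg fun _ => tvDist_nonneg _ _

/-- `‖Pᵗ(x,·) − π‖_TV ≤ d(t)` for every starting state `x`. [cite: LevinPeres2017, §4.4 eq. (4.22)] -/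
theorem tvDist_single_le_worstTvDist (P : X → X → ℝ) (π : X → ℝ) (t : ℕ) (x : X) :
    tvDist (lawAt P (Pi.single x 1) t) π ≤ worstTvDist P π t :=
  le_ciSup (f := fun x => tvDist (lawAt P (Pi.single x 1) t) π) (Set.finite_range _).bddAbove x

/-- The maximum in `d(t)` is attained (finite nonempty `X`). [cite: LevinPeres2017, §4.4 eq. (4.22)] -/
theorem exists_tvDist_single_eq_worstTvDist [Nonempty X] (P : X → X → ℝ) (π : X → ℝ) (t : ℕ) :
    ∃ x, tvDist (lawAt P (Pi.single x 1) t) π = worstTvDist P π t := by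
  obtain ⟨x, hx⟩ := exists_eq_ciSup_of_finite (f := fun x => tvDist (lawAt P (Pi.single x 1) t) π)
  exact ⟨x, hx⟩

/-- Linearity of the chain in its initial law: `μPᵗ = Σ_x μ(x) · δ_x Pᵗ`, i.e.
`(μPᵗ)(y) = Σ_x μ(x) Pᵗ(x,y)`. [cite: LevinPeres2017, §1.1 (`μ_t = μ_0 Pᵗ`, matrix form)] -/
theorem lawAt_eq_sum_mul_lawAt_single (P : X → X → ℝ) (μ : X → ℝ) (t : ℕ) (y : X) :
    lawAt P μ t y = ∑ x, μ x * lawAt P (Pi.single x 1) t y := by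
  induction t generalizing y with
  | zero =>
    simp only [lawAt_zero, Pi.single_apply, mul_ite, mul_one, mul_zero, Finset.sum_ite_eq,
      Finset.mem_univ, if_true]
  | succ t ih =>
    simp only [lawAt_succ, stepLaw]
    calc ∑ z, lawAt P μ t z * P z y
        = ∑ z, (∑ x, μ x * lawAt P (Pi.single x 1) t z) * P z y :=
          sum_congr rfl fun z _ => by rw [ih z]
      _ = ∑ z, ∑ x, μ x * (lawAt P (Pi.single x 1) t z * P z y) := by
          refine sum_congr rfl fun z _ => ?_
          rw [sum_mul]
          exact sum_congr rfl fun x _ => by ring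
      _ = ∑ x, μ x * ∑ z, lawAt P (Pi.single x 1) t z * P z y := by
          rw [sum_comm]
          exact sum_congr rfl fun x _ => by rw [mul_sum]

/-- **`‖μPᵗ − π‖_TV ≤ d(t)`** for every probability vector `μ` (convexity of total variation in the
first argument and linearity in the initial law).
[cite: LevinPeres2017, §4.5 Exercise 4.1 (`d(t) = sup_μ ‖μPᵗ − π‖_TV`, the direction `≤`)] -/
theorem tvDist_lawAt_le_worstTvDist (P : X → X → ℝ) (π : X → ℝ) {μ : X → ℝ} (hμ : ∀ x, 0 ≤ μ x)
    (hμ1 : ∑ x, μ x = 1) (t : ℕ) : tvDist (lawAt P μ t) π ≤ worstTvDist P π t := by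
  set L : X → X → ℝ := fun x => lawAt P (Pi.single x 1) t with hL
  -- pointwise: |(μPᵗ)(y) − π(y)| = |Σ_x μ x (L x y − π y)| ≤ Σ_x μ x |L x y − π y|
  have hpt : ∀ y, |lawAt P μ t y - π y| ≤ ∑ x, μ x * |L x y - π y| := by
    intro y
    have h1 : lawAt P μ t y - π y = ∑ x, μ x * (L x y - π y) := by
      rw [lawAt_eq_sum_mul_lawAt_single]
      simp only [mul_sub, sum_sub_distrib, ← sum_mul, hμ1, one_mul, hL]
    rw [h1]
    refine (abs_sum_le_sum_abs _ _).trans (le_of_eq (sum_congr rfl fun x _ => ?_))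
    rw [abs_mul, abs_of_nonneg (hμ x)]
  calc tvDist (lawAt P μ t) π
      = (1 / 2) * ∑ y, |lawAt P μ t y - π y| := rfl
    _ ≤ (1 / 2) * ∑ y, ∑ x, μ x * |L x y - π y| :=
        mul_le_mul_of_nonneg_left (sum_le_sum fun y _ => hpt y) (by norm_num)
    _ = ∑ x, μ x * tvDist (L x) π := by
        rw [sum_comm, mul_sum]
        refine sum_congr rfl fun x _ => ?_
        unfold tvDist
        rw [mul_sum, mul_sum, mul_sum]
        exact sum_congr rfl fun y _ => by ring
    _ ≤ ∑ x, μ x * worstTvDist P π t :=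
        sum_le_sum fun x _ => mul_le_mul_of_nonneg_left (tvDist_single_le_worstTvDist P π t x) (hμ x)
    _ = worstTvDist P π t := by rw [← sum_mul, hμ1, one_mul]

/-- `d` is non-increasing in `t` (row-stochastic `P` with `πP = π`): each `‖Pᵗ(x,·) − π‖_TV` is
non-increasing (`TotalVariation.tvDist_lawAt_antitone`). [cite: LevinPeres2017, §4.5 (Exercise 4.2:
advancing the chain can only move it closer to stationarity)] -/
theorem worstTvDist_antitone {P : X → X → ℝ} (hP : IsRowStochastic P) {π : X → ℝ}
    (hπ : IsStationary π P) : Antitone (worstTvDist P π) := by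
  intro s t hst
  refine Real.iSup_le (fun x => ?_) (worstTvDist_nonneg P π s)
  exact (tvDist_lawAt_antitone hP hπ _ hst).trans (tvDist_single_le_worstTvDist P π s x)

/-- If `d(t₀) ≤ ε` for some `t₀`, then `d(t_mix(ε)) ≤ ε`. [cite: LevinPeres2017, §4.5 eq. (4.30)] -/
theorem worstTvDist_mixingTime_le (P : X → X → ℝ) (π : X → ℝ) {ε : ℝ} {t₀ : ℕ}
    (h : worstTvDist P π t₀ ≤ ε) : worstTvDist P π (mixingTime P π ε) ≤ ε :=
  Nat.sInf_mem (s := {t | worstTvDist P π t ≤ ε}) ⟨t₀, h⟩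

/-- `t_mix(ε) ≤ t₀` for every `t₀` with `d(t₀) ≤ ε`. [cite: LevinPeres2017, §4.5 eq. (4.30)] -/
theorem mixingTime_le (P : X → X → ℝ) (π : X → ℝ) {ε : ℝ} {t₀ : ℕ} (h : worstTvDist P π t₀ ≤ ε) :
    mixingTime P π ε ≤ t₀ :=
  Nat.sInf_le h

/-- Every `t ≥ t_mix(ε)` has `d(t) ≤ ε`, provided some time does (row-stochastic `P`, `πP = π`).
[cite: LevinPeres2017, §4.5 eq. (4.30) with Exercise 4.2] -/
theorem worstTvDist_le_of_mixingTime_le {P : X → X → ℝ} (hP : IsRowStochastic P) {π : X → ℝ}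
    (hπ : IsStationary π P) {ε : ℝ} {t₀ t : ℕ} (h : worstTvDist P π t₀ ≤ ε)
    (ht : mixingTime P π ε ≤ t) : worstTvDist P π t ≤ ε :=
  (worstTvDist_antitone hP hπ ht).trans (worstTvDist_mixingTime_le P π h)

/-- The fixed-start mixing time of `TotalVariation.lean` is at most `t_mix(ε)`: a chain that is
`ε`-close from the worst start is `ε`-close from every probability vector `μ`.
[cite: LevinPeres2017, §4.5 eq. (4.30) with Exercise 4.1] -/
theorem mixingTimeFrom_le_mixingTime (P : X → X → ℝ) (π : X → ℝ) {μ : X → ℝ} (hμ : ∀ x, 0 ≤ μ x)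
    (hμ1 : ∑ x, μ x = 1) {ε : ℝ} {t₀ : ℕ} (h : worstTvDist P π t₀ ≤ ε) :
    mixingTimeFrom P μ π ε ≤ mixingTime P π ε :=
  mixingTimeFrom_le P μ π
    ((tvDist_lawAt_le_worstTvDist P π hμ hμ1 _).trans (worstTvDist_mixingTime_le P π h))

/-! ## Edge measure, bottleneck ratio, `Φ⋆` -/

/-- The edge measure `Q(A,B) = Σ_{x ∈ A, y ∈ B} π(x) P(x,y)` — the probability of moving from `A`
to `B` in one step when started from `π`. [cite: LevinPeres2017, §7.2 eq. (7.5)] -/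
def edgeMeasure (π : X → ℝ) (P : X → X → ℝ) (A B : Finset X) : ℝ := ∑ x ∈ A, ∑ y ∈ B, π x * P x y

/-- The bottleneck ratio of the set `S`: `Φ(S) = Q(S,Sᶜ)/π(S)` (Lean: `= 0` when `π(S) = 0`, where
the printed quotient is undefined). [cite: LevinPeres2017, §7.2 eq. (7.6)] -/
noncomputable def bottleneckRatio (π : X → ℝ) (P : X → X → ℝ) (S : Finset X) : ℝ :=
  edgeMeasure π P S Sᶜ / ∑ x ∈ S, π x

/-- The bottleneck ratio of the chain (expansion): `Φ⋆ = min {Φ(S) : π(S) ≤ 1/2}`, the minimum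
over the sets with `0 < π(S) ≤ 1/2` (the sets on which the printed `Φ(S)` is defined; for an
irreducible chain, all nonempty `S` with `π(S) ≤ 1/2`).  It is attained
(`exists_bottleneckRatioStar_eq`); junk value `sInf ∅ = 0` when no such set exists (e.g. a
one-point space). [cite: LevinPeres2017, §7.2 eq. (7.7)] -/
noncomputable def bottleneckRatioStar (π : X → ℝ) (P : X → X → ℝ) : ℝ :=
  sInf (bottleneckRatio π P '' {S | 0 < ∑ x ∈ S, π x ∧ ∑ x ∈ S, π x ≤ 1 / 2})

/-- `π` conditioned on `S`: `π(x)/π(S)` on `S`, `0` off `S` — the law of `X₀` given `X₀ ∈ S` for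
the stationary chain, so that `(condLaw π S · Pᵗ)(Sᶜ) = P_π{X_t ∈ Sᶜ | X₀ ∈ S}` of eq. (7.10).
[cite: LevinPeres2017, §7.2, proof of Thm 7.4 (eq. (7.10))] -/
noncomputable def condLaw (π : X → ℝ) (S : Finset X) : X → ℝ :=
  fun x => if x ∈ S then π x / ∑ y ∈ S, π y else 0

omit [Fintype X] [DecidableEq X] in
/-- `Q(A,B) ≥ 0` for `π ≥ 0` and `P ≥ 0`. [cite: LevinPeres2017, §7.2 eq. (7.5)] -/
theorem edgeMeasure_nonneg {π : X → ℝ} (hπ0 : ∀ x, 0 ≤ π x) {P : X → X → ℝ}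
    (hP0 : ∀ x y, 0 ≤ P x y) (A B : Finset X) : 0 ≤ edgeMeasure π P A B :=
  sum_nonneg fun x _ => sum_nonneg fun y _ => mul_nonneg (hπ0 x) (hP0 x y)

/-- `Φ(S) ≥ 0` for `π ≥ 0` and `P ≥ 0`. [cite: LevinPeres2017, §7.2 eq. (7.6)] -/
theorem bottleneckRatio_nonneg {π : X → ℝ} (hπ0 : ∀ x, 0 ≤ π x) {P : X → X → ℝ}
    (hP0 : ∀ x y, 0 ≤ P x y) (S : Finset X) : 0 ≤ bottleneckRatio π P S :=
  div_nonneg (edgeMeasure_nonneg hπ0 hP0 S Sᶜ) (sum_nonneg fun x _ => hπ0 x)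

/-- `Φ⋆ ≤ Φ(S)` for every `S` with `0 < π(S) ≤ 1/2`. [cite: LevinPeres2017, §7.2 eq. (7.7)] -/
theorem bottleneckRatioStar_le (π : X → ℝ) (P : X → X → ℝ) {S : Finset X}
    (hS0 : 0 < ∑ x ∈ S, π x) (hS : ∑ x ∈ S, π x ≤ 1 / 2) :
    bottleneckRatioStar π P ≤ bottleneckRatio π P S :=
  csInf_le (Set.toFinite _).bddBelow ⟨S, ⟨hS0, hS⟩, rfl⟩

/-- The minimum defining `Φ⋆` is attained: if some `S` has `0 < π(S) ≤ 1/2`, then `Φ⋆ = Φ(S₀)` for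
such an `S₀`. [cite: LevinPeres2017, §7.2 eq. (7.7)] -/
theorem exists_bottleneckRatioStar_eq (π : X → ℝ) (P : X → X → ℝ)
    (h : ∃ S : Finset X, 0 < ∑ x ∈ S, π x ∧ ∑ x ∈ S, π x ≤ 1 / 2) :
    ∃ S : Finset X, (0 < ∑ x ∈ S, π x ∧ ∑ x ∈ S, π x ≤ 1 / 2) ∧
      bottleneckRatio π P S = bottleneckRatioStar π P := by
  obtain ⟨S, hS⟩ := h
  have hne : (bottleneckRatio π P '' {S | 0 < ∑ x ∈ S, π x ∧ ∑ x ∈ S, π x ≤ 1 / 2}).Nonempty :=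
    ⟨_, S, hS, rfl⟩
  obtain ⟨S₀, hS₀, h₀⟩ := hne.csInf_mem (Set.toFinite _)
  exact ⟨S₀, hS₀, h₀⟩

/-- `Φ⋆ ≥ 0` for `π ≥ 0`, `P ≥ 0`. [cite: LevinPeres2017, §7.2 eq. (7.7)] -/
theorem bottleneckRatioStar_nonneg {π : X → ℝ} (hπ0 : ∀ x, 0 ≤ π x) {P : X → X → ℝ}
    (hP0 : ∀ x y, 0 ≤ P x y) : 0 ≤ bottleneckRatioStar π P := by
  unfold bottleneckRatioStar
  by_cases hne : (bottleneckRatio π P '' {S | 0 < ∑ x ∈ S, π x ∧ ∑ x ∈ S, π x ≤ 1 / 2}).Nonempty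
  · exact le_csInf hne (by rintro _ ⟨S, _, rfl⟩; exact bottleneckRatio_nonneg hπ0 hP0 S)
  · rw [Set.not_nonempty_iff_eq_empty.mp hne, Real.sInf_empty]

/-! ## The conditional law and eq. (7.10) -/

omit [Fintype X] in
/-- `condLaw π S` is non-negative for `π ≥ 0`. [cite: LevinPeres2017, §7.2, proof of Thm 7.4] -/
theorem condLaw_nonneg {π : X → ℝ} (hπ0 : ∀ x, 0 ≤ π x) (S : Finset X) (x : X) :
    0 ≤ condLaw π S x := by
  unfold condLaw
  split_ifs
  · exact div_nonneg (hπ0 x) (sum_nonneg fun y _ => hπ0 y)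
  · exact le_rfl

omit [Fintype X] in
/-- `condLaw π S` vanishes off `S`. [cite: LevinPeres2017, §7.2, proof of Thm 7.4] -/
theorem condLaw_of_not_mem {π : X → ℝ} {S : Finset X} {x : X} (hx : x ∉ S) : condLaw π S x = 0 := by
  unfold condLaw; rw [if_neg hx]

/-- `condLaw π S` has total mass `1` when `π(S) > 0`. [cite: LevinPeres2017, §7.2, proof of Thm 7.4] -/
theorem sum_condLaw {π : X → ℝ} {S : Finset X} (hS0 : 0 < ∑ x ∈ S, π x) :
    ∑ x, condLaw π S x = 1 := by
  unfold condLaw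
  rw [← sum_add_sum_compl S]
  have h1 : ∑ x ∈ S, (if x ∈ S then π x / ∑ y ∈ S, π y else 0) = ∑ x ∈ S, π x / ∑ y ∈ S, π y :=
    sum_congr rfl fun x hx => by rw [if_pos hx]
  have h2 : ∑ x ∈ Sᶜ, (if x ∈ S then π x / ∑ y ∈ S, π y else 0) = 0 :=
    sum_eq_zero fun x hx => by rw [if_neg (Finset.mem_compl.mp hx)]
  rw [h1, h2, add_zero, ← sum_div, div_self hS0.ne']

/-- The mass of `condLaw π S` on `S` is `1` when `π(S) > 0`. [cite: LevinPeres2017, §7.2, proof of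
Thm 7.4] -/
theorem sum_mem_condLaw {π : X → ℝ} {S : Finset X} (hS0 : 0 < ∑ x ∈ S, π x) :
    ∑ x ∈ S, condLaw π S x = 1 := by
  have h := sum_condLaw (π := π) hS0
  rw [← sum_add_sum_compl S] at h
  have h2 : ∑ x ∈ Sᶜ, condLaw π S x = 0 :=
    sum_eq_zero fun x hx => condLaw_of_not_mem (Finset.mem_compl.mp hx)
  linarith

/-- Pointwise domination `(condLaw π S · Pᵗ)(y) ≤ π(y)/π(S)` for all `t` (stationarity of `π`,
`P ≥ 0`): the conditioned stationary chain never exceeds `π/π(S)`.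
[cite: LevinPeres2017, §7.2, proof of Thm 7.4 (the stationary chain `(X_t)` with `X₀ ∼ π`)] -/
theorem lawAt_condLaw_le {P : X → X → ℝ} (hP : IsRowStochastic P) {π : X → ℝ}
    (hπ : IsStationary π P) (hπ0 : ∀ x, 0 ≤ π x) {S : Finset X} (hS0 : 0 < ∑ x ∈ S, π x)
    (t : ℕ) (y : X) : lawAt P (condLaw π S) t y ≤ π y / ∑ x ∈ S, π x := by
  induction t generalizing y with
  | zero =>
    rw [lawAt_zero]
    unfold condLaw
    split_ifs
    · exact le_rfl
    · exact div_nonneg (hπ0 y) hS0.le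
  | succ t ih =>
    rw [lawAt_succ]
    show ∑ x, lawAt P (condLaw π S) t x * P x y ≤ π y / ∑ x ∈ S, π x
    calc ∑ x, lawAt P (condLaw π S) t x * P x y
        ≤ ∑ x, π x / (∑ z ∈ S, π z) * P x y :=
          sum_le_sum fun x _ => mul_le_mul_of_nonneg_right (ih x) (hP.1 x y)
      _ = (∑ x, π x * P x y) / ∑ z ∈ S, π z := by
          rw [sum_div]; exact sum_congr rfl fun x _ => by ring
      _ = π y / ∑ z ∈ S, π z := by rw [hπ y]

/-- One step of eq. (7.10): `P_π{X_{t+1} ∈ Sᶜ | X₀ ∈ S} ≤ P_π{X_t ∈ Sᶜ | X₀ ∈ S} + Φ(S)` — the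
summand `P_π{X_t ∈ S, X_{t+1} ∈ Sᶜ}/π(S) ≤ Q(S,Sᶜ)/π(S)` of the printed union bound.
[cite: LevinPeres2017, §7.2, proof of Thm 7.4 (display before eq. (7.10))] -/
theorem sum_compl_lawAt_condLaw_succ_le {P : X → X → ℝ} (hP : IsRowStochastic P) {π : X → ℝ}
    (hπ : IsStationary π P) (hπ0 : ∀ x, 0 ≤ π x) {S : Finset X} (hS0 : 0 < ∑ x ∈ S, π x)
    (t : ℕ) :
    ∑ y ∈ Sᶜ, lawAt P (condLaw π S) (t + 1) y ≤
      ∑ y ∈ Sᶜ, lawAt P (condLaw π S) t y + bottleneckRatio π P S := by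
  set ν : X → ℝ := lawAt P (condLaw π S) t with hν
  have hν0 : ∀ x, 0 ≤ ν x := fun x => lawAt_nonneg hP (condLaw_nonneg hπ0 S) t x
  -- mass leaving to `Sᶜ` in one step, split by the current position
  have hstep : ∑ y ∈ Sᶜ, lawAt P (condLaw π S) (t + 1) y = ∑ x, ν x * ∑ y ∈ Sᶜ, P x y := by
    rw [lawAt_succ]
    show ∑ y ∈ Sᶜ, ∑ x, ν x * P x y = _
    rw [sum_comm]
    exact sum_congr rfl fun x _ => by rw [mul_sum]
  rw [hstep, ← sum_add_sum_compl S (fun x => ν x * ∑ y ∈ Sᶜ, P x y)]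
  -- from inside `S`: bounded by `Φ(S)` via the pointwise domination `ν ≤ π/π(S)`
  have hin : ∑ x ∈ S, ν x * ∑ y ∈ Sᶜ, P x y ≤ bottleneckRatio π P S := by
    calc ∑ x ∈ S, ν x * ∑ y ∈ Sᶜ, P x y
        ≤ ∑ x ∈ S, π x / (∑ z ∈ S, π z) * ∑ y ∈ Sᶜ, P x y :=
          sum_le_sum fun x _ => mul_le_mul_of_nonneg_right
            (lawAt_condLaw_le hP hπ hπ0 hS0 t x) (sum_nonneg fun y _ => hP.1 x y)
      _ = bottleneckRatio π P S := by
          unfold bottleneckRatio edgeMeasure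
          rw [sum_div]
          refine sum_congr rfl fun x _ => ?_
          rw [sum_div, mul_sum]
          exact sum_congr rfl fun y _ => by ring
  -- from inside `Sᶜ`: bounded by the mass already in `Sᶜ`
  have hout : ∑ x ∈ Sᶜ, ν x * ∑ y ∈ Sᶜ, P x y ≤ ∑ x ∈ Sᶜ, ν x := by
    refine sum_le_sum fun x _ => ?_
    have h1 : ∑ y ∈ Sᶜ, P x y ≤ 1 := by
      calc ∑ y ∈ Sᶜ, P x y ≤ ∑ y, P x y :=
            sum_le_sum_of_subset_of_nonneg (subset_univ _) fun y _ _ => hP.1 x y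
        _ = 1 := hP.2 x
    calc ν x * ∑ y ∈ Sᶜ, P x y ≤ ν x * 1 := mul_le_mul_of_nonneg_left h1 (hν0 x)
      _ = ν x := mul_one _
  linarith

/-- **Eq. (7.10)**: `P_π{X_t ∈ Sᶜ | X₀ ∈ S} ≤ t · Φ(S)` — in vector form,
`Σ_{y ∉ S} (condLaw π S · Pᵗ)(y) ≤ t · Φ(S)`, for a row-stochastic `P` with `πP = π`, `π ≥ 0`,
`π(S) > 0`. [cite: LevinPeres2017, §7.2, proof of Thm 7.4, eq. (7.10)] -/
theorem sum_compl_lawAt_condLaw_le {P : X → X → ℝ} (hP : IsRowStochastic P) {π : X → ℝ}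
    (hπ : IsStationary π P) (hπ0 : ∀ x, 0 ≤ π x) {S : Finset X} (hS0 : 0 < ∑ x ∈ S, π x)
    (t : ℕ) : ∑ y ∈ Sᶜ, lawAt P (condLaw π S) t y ≤ t * bottleneckRatio π P S := by
  induction t with
  | zero =>
    rw [lawAt_zero, Nat.cast_zero, zero_mul]
    exact le_of_eq (sum_eq_zero fun y hy => condLaw_of_not_mem (Finset.mem_compl.mp hy))
  | succ t ih =>
    have h := sum_compl_lawAt_condLaw_succ_le hP hπ hπ0 hS0 t
    push_cast
    linarith

/-- "So there exists `x` with `Pᵗ(x,S) ≥ 1 − tΦ(S)`": some state `x ∈ S` (with `π(x) > 0`) has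
`Pᵗ(x,Sᶜ) ≤ t · Φ(S)` (a weighted average is attained from below by one of its terms).
[cite: LevinPeres2017, §7.2, proof of Thm 7.4 (sentence after eq. (7.10))] -/
theorem exists_mem_sum_compl_lawAt_single_le {P : X → X → ℝ} (hP : IsRowStochastic P)
    {π : X → ℝ} (hπ : IsStationary π P) (hπ0 : ∀ x, 0 ≤ π x) {S : Finset X}
    (hS0 : 0 < ∑ x ∈ S, π x) (t : ℕ) :
    ∃ x ∈ S, 0 < π x ∧ ∑ y ∈ Sᶜ, lawAt P (Pi.single x 1) t y ≤ t * bottleneckRatio π P S := by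
  -- the conditioned law's exit mass is the `condLaw`-weighted average of the single-start ones
  have havg : ∑ x ∈ S, condLaw π S x * ∑ y ∈ Sᶜ, lawAt P (Pi.single x 1) t y ≤
      t * bottleneckRatio π P S := by
    have h1 : ∑ y ∈ Sᶜ, lawAt P (condLaw π S) t y =
        ∑ x, condLaw π S x * ∑ y ∈ Sᶜ, lawAt P (Pi.single x 1) t y :=
      calc ∑ y ∈ Sᶜ, lawAt P (condLaw π S) t y
          = ∑ y ∈ Sᶜ, ∑ x, condLaw π S x * lawAt P (Pi.single x 1) t y :=
            sum_congr rfl fun y _ => lawAt_eq_sum_mul_lawAt_single P _ t y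
        _ = ∑ x, ∑ y ∈ Sᶜ, condLaw π S x * lawAt P (Pi.single x 1) t y := sum_comm
        _ = ∑ x, condLaw π S x * ∑ y ∈ Sᶜ, lawAt P (Pi.single x 1) t y :=
            sum_congr rfl fun x _ => by rw [mul_sum]
    have h2 : ∑ x, condLaw π S x * ∑ y ∈ Sᶜ, lawAt P (Pi.single x 1) t y =
        ∑ x ∈ S, condLaw π S x * ∑ y ∈ Sᶜ, lawAt P (Pi.single x 1) t y := by
      rw [← sum_add_sum_compl S (fun x => condLaw π S x * ∑ y ∈ Sᶜ, lawAt P (Pi.single x 1) t y)]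
      have : ∑ x ∈ Sᶜ, condLaw π S x * ∑ y ∈ Sᶜ, lawAt P (Pi.single x 1) t y = 0 :=
        sum_eq_zero fun x hx => by rw [condLaw_of_not_mem (Finset.mem_compl.mp hx), zero_mul]
      rw [this, add_zero]
    rw [← h2, ← h1]
    exact sum_compl_lawAt_condLaw_le hP hπ hπ0 hS0 t
  -- restrict to the states of `S` carrying positive weight
  have hSp_ne : (S.filter (fun x => 0 < π x)).Nonempty := by
    obtain ⟨x, hxS, hx⟩ := exists_lt_of_sum_lt (s := S) (f := fun _ => (0 : ℝ)) (g := π)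
      (by rw [sum_const_zero]; exact hS0)
    exact ⟨x, Finset.mem_filter.mpr ⟨hxS, hx⟩⟩
  have hzero : ∀ x ∈ S, x ∉ S.filter (fun x => 0 < π x) → condLaw π S x = 0 := by
    intro x hxS hxSp
    have hπx : π x = 0 := by
      have : ¬ 0 < π x := fun h => hxSp (Finset.mem_filter.mpr ⟨hxS, h⟩)
      exact le_antisymm (not_lt.mp this) (hπ0 x)
    unfold condLaw; rw [if_pos hxS, hπx, zero_div]
  have hsumSp : ∀ f : X → ℝ,
      ∑ x ∈ S.filter (fun x => 0 < π x), condLaw π S x * f x = ∑ x ∈ S, condLaw π S x * f x := by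
    intro f
    rw [sum_filter]
    refine sum_congr rfl fun x hxS => ?_
    split_ifs with h
    · rfl
    · rw [hzero x hxS (fun hmem => h (Finset.mem_filter.mp hmem).2), zero_mul]
  have hle : ∑ x ∈ S.filter (fun x => 0 < π x),
        condLaw π S x * ∑ y ∈ Sᶜ, lawAt P (Pi.single x 1) t y ≤
      ∑ x ∈ S.filter (fun x => 0 < π x), condLaw π S x * (t * bottleneckRatio π P S) := by
    rw [hsumSp (fun x => ∑ y ∈ Sᶜ, lawAt P (Pi.single x 1) t y),
      hsumSp (fun _ => t * bottleneckRatio π P S), ← sum_mul, sum_mem_condLaw hS0, one_mul]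
    exact havg
  obtain ⟨x, hxSp, hx⟩ := exists_le_of_sum_le hSp_ne hle
  obtain ⟨hxS, hπx⟩ := Finset.mem_filter.mp hxSp
  have hwx : 0 < condLaw π S x := by
    unfold condLaw; rw [if_pos hxS]; exact div_pos hπx hS0
  exact ⟨x, hxS, hπx, le_of_mul_le_mul_left hx hwx⟩

/-- "Therefore `d(t) ≥ 1 − tΦ(S) − π(S)`" for every `S` with `π(S) > 0` (row-stochastic `P`,
`πP = π`, `π` a probability vector). [cite: LevinPeres2017, §7.2, proof of Thm 7.4 (display after
eq. (7.10))] -/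
theorem one_sub_sub_le_worstTvDist {P : X → X → ℝ} (hP : IsRowStochastic P) {π : X → ℝ}
    (hπ : IsStationary π P) (hπ0 : ∀ x, 0 ≤ π x) (hπ1 : ∑ x, π x = 1) {S : Finset X}
    (hS0 : 0 < ∑ x ∈ S, π x) (t : ℕ) :
    1 - t * bottleneckRatio π P S - ∑ x ∈ S, π x ≤ worstTvDist P π t := by
  obtain ⟨x, _, _, hx⟩ := exists_mem_sum_compl_lawAt_single_le hP hπ hπ0 hS0 t
  -- `Pᵗ(x,·)` is a probability vector (cf. `Scoring.sum_lawAt_single` on the venture side)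
  have h1 : ∑ y, lawAt P (Pi.single x 1) t y = 1 := by
    rw [sum_lawAt hP, Finset.sum_pi_single']
    simp
  have hmass : ∑ y, lawAt P (Pi.single x 1) t y = ∑ y, π y := by rw [h1, hπ1]
  -- event form of total variation with `A = S`
  have hev : ∑ y ∈ S, lawAt P (Pi.single x 1) t y - ∑ y ∈ S, π y ≤
      tvDist (lawAt P (Pi.single x 1) t) π := sub_sum_le_tvDist hmass S
  have hLS : ∑ y ∈ S, lawAt P (Pi.single x 1) t y = 1 - ∑ y ∈ Sᶜ, lawAt P (Pi.single x 1) t y := by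
    have := sum_add_sum_compl S (lawAt P (Pi.single x 1) t)
    linarith
  have hd := tvDist_single_le_worstTvDist P π t x
  linarith

/-- General-`ε` form of the bottleneck bound: if `d(t) ≤ ε` then `1 − π(S) − ε ≤ t · Φ(S)` for
every `S` with `π(S) > 0`; i.e. `t_mix(ε) ≥ (π(Sᶜ) − ε)/Φ(S)`.
[cite: LevinPeres2017, §7.2, proof of Thm 7.4] -/
theorem one_sub_sub_le_mul_bottleneckRatio {P : X → X → ℝ} (hP : IsRowStochastic P) {π : X → ℝ}
    (hπ : IsStationary π P) (hπ0 : ∀ x, 0 ≤ π x) (hπ1 : ∑ x, π x = 1) {S : Finset X}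
    (hS0 : 0 < ∑ x ∈ S, π x) {t : ℕ} {ε : ℝ} (ht : worstTvDist P π t ≤ ε) :
    1 - ∑ x ∈ S, π x - ε ≤ t * bottleneckRatio π P S := by
  have h := one_sub_sub_le_worstTvDist hP hπ hπ0 hπ1 hS0 t
  linarith

/-! ## Theorem 7.4 -/

/-- **Theorem 7.4, per set** ("Therefore `t_mix ≥ 1/[4Φ(A)]`"): for a row-stochastic `P` with
stationary probability vector `π` and any `S` with `0 < π(S) ≤ 1/2`, every `t` with `d(t) ≤ 1/4`
satisfies `1 ≤ 4 · t · Φ(S)` (division-free form of `t ≥ 1/(4Φ(S))`; in particular no such `t`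
exists when `Φ(S) = 0`). [cite: LevinPeres2017, §7.2 Thm 7.4 (proof, last display)] -/
theorem LevinPeres2017_thm_7_4_set {P : X → X → ℝ} (hP : IsRowStochastic P) {π : X → ℝ}
    (hπ : IsStationary π P) (hπ0 : ∀ x, 0 ≤ π x) (hπ1 : ∑ x, π x = 1) {S : Finset X}
    (hS0 : 0 < ∑ x ∈ S, π x) (hS : ∑ x ∈ S, π x ≤ 1 / 2) {t : ℕ}
    (ht : worstTvDist P π t ≤ 1 / 4) : 1 ≤ 4 * t * bottleneckRatio π P S := by
  have h := one_sub_sub_le_mul_bottleneckRatio hP hπ hπ0 hπ1 hS0 ht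
  linarith

/-- **Theorem 7.4** (`t_mix ≥ 1/(4Φ⋆)`, division-free form): for a row-stochastic `P` with
stationary probability vector `π` on a space with at least one set of mass `0 < π(S) ≤ 1/2`, every
`t` with `d(t) ≤ 1/4` satisfies `1 ≤ 4 · t · Φ⋆`. [cite: LevinPeres2017, §7.2 Thm 7.4 eq. (7.9)] -/
theorem LevinPeres2017_thm_7_4 {P : X → X → ℝ} (hP : IsRowStochastic P) {π : X → ℝ}
    (hπ : IsStationary π P) (hπ0 : ∀ x, 0 ≤ π x) (hπ1 : ∑ x, π x = 1)
    (hX : ∃ S : Finset X, 0 < ∑ x ∈ S, π x ∧ ∑ x ∈ S, π x ≤ 1 / 2) {t : ℕ}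
    (ht : worstTvDist P π t ≤ 1 / 4) : 1 ≤ 4 * t * bottleneckRatioStar π P := by
  obtain ⟨S, ⟨hS0, hS⟩, hSeq⟩ := exists_bottleneckRatioStar_eq π P hX
  rw [← hSeq]
  exact LevinPeres2017_thm_7_4_set hP hπ hπ0 hπ1 hS0 hS ht

/-- **Theorem 7.4 as printed**: `t_mix = t_mix(1/4) ≥ 1/(4Φ⋆)`, for a row-stochastic `P` with
stationary probability vector `π` that is `1/4`-close to `π` at some time (e.g. irreducible and
aperiodic).  (When no set has `0 < π(S) ≤ 1/2`, or `Φ⋆ = 0`, the left side is Lean's `1/0 = 0`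
and the inequality is trivial; the division-free content is `LevinPeres2017_thm_7_4`.)
[cite: LevinPeres2017, §7.2 Thm 7.4 eq. (7.9)] -/
theorem LevinPeres2017_thm_7_4_tmix {P : X → X → ℝ} (hP : IsRowStochastic P) {π : X → ℝ}
    (hπ : IsStationary π P) (hπ0 : ∀ x, 0 ≤ π x) (hπ1 : ∑ x, π x = 1)
    (hmix : ∃ t, worstTvDist P π t ≤ 1 / 4) :
    1 / (4 * bottleneckRatioStar π P) ≤ (mixingTime P π (1 / 4) : ℝ) := by
  obtain ⟨t₀, ht₀⟩ := hmix
  have hstar0 : 0 ≤ bottleneckRatioStar π P := bottleneckRatioStar_nonneg hπ0 hP.1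
  by_cases hX : ∃ S : Finset X, 0 < ∑ x ∈ S, π x ∧ ∑ x ∈ S, π x ≤ 1 / 2
  · rcases hstar0.lt_or_eq with hpos | hzero
    · have h : (1 : ℝ) ≤ 4 * (mixingTime P π (1 / 4) : ℕ) * bottleneckRatioStar π P :=
        LevinPeres2017_thm_7_4 hP hπ hπ0 hπ1 hX (worstTvDist_mixingTime_le P π ht₀)
      rw [div_le_iff₀ (by positivity)]
      linarith
    · rw [← hzero, mul_zero, div_zero]; exact Nat.cast_nonneg _
  · have hempty : bottleneckRatio π P '' {S | 0 < ∑ x ∈ S, π x ∧ ∑ x ∈ S, π x ≤ 1 / 2} = ∅ := by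
      refine Set.eq_empty_of_forall_notMem ?_
      rintro _ ⟨S, hS, rfl⟩
      exact hX ⟨S, hS⟩
    unfold bottleneckRatioStar
    rw [hempty, Real.sInf_empty, mul_zero, div_zero]
    exact Nat.cast_nonneg _

end Literature.Probability.MarkovChains
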